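import Summits.NavierStokesRegularity.FluidComputer.RowEncloseSub
import Summits.NavierStokesRegularity.FluidComputer.RowPhaseSound
import HarnessLib

/-!
# Enclosure soundness IV: the coefficient hull `B`, the forcing coefficients `CF` and `|AP̃|`
# over the whole row (`pub-fluidc-bp3/R1-DESIGN.md` §9.2 / §9.4, layer B of `structure Row`)

HONEST FRAMING (cell `pub-fluidc`, blueprint seat bp3, gen 20): low prior, high value-of-information
experiment on Tao's machine paradigm; NOT a claim that NS blows up. Interval bookkeeping only.

Every `u ∈ [0,H]` lies in one of the `KSUB` sub-intervals together with its parameter `v = u/H`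
(`exists_sub`); the accumulation `sb'` dominates every sub-interval (`subsAcc_mono`); hence the
three
row-level `Cert` fields in the real views of `RowScaleSound` / `RowPhaseSound`:
* `K_le` (`Cert.hKB`): `|K₀ + ṡM + c·[i=j]| ≤ BR` for `|ṡ − 1| ≤ ρ`;
* `CF_le` (`Cert.hCF`): `|ȦR| + (1+ρ)|AP̃JR| ≤ CFR`;
* `APm_le` (`Cert.hAPm`): `|AP̃| ≤ APmR`.
The side conditions the kernel takes for granted (`0 < KSUB`, the interval of `H` is positive,
`deg x̂ ≤ DEG`, `msub ≤ S`) are the Boolean `encOK`, decided per row like `rowPass`.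

[cite: Tao2016AveragedNS, §5.5 Thm 5.3 (5.5)]
-/

namespace Summit.NavierStokesRegularity.FluidComputer

open Literature.Analysis.FluidPDE.FluidComputer
open Literature.Analysis.ValidatedNumerics.Numerics (cdiv)

namespace RowCheck

open DIVec ChainField Finset Real Set

namespace RowData

variable (r : RowData)

/-- Side conditions the kernel takes for granted: at least one sub-interval, `⌊H·2^P⌋ > 0`, the
reference polynomials have degree `≤ DEG`, and the block split `msub ≤ S`. [folklore] -/
def encOK : Bool :=
  decide (0 < r.KSUB) && decide (0 < (ofFrac r.P r.Hq).lo) &&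
    decide (∀ i : Fin 9, (r.CQ i).length ≤ r.DEG + 1) && decide (r.msub ≤ r.S)

/-- [folklore] -/
theorem encOK_iff : r.encOK = true ↔
    0 < r.KSUB ∧ 0 < (ofFrac r.P r.Hq).lo ∧ (∀ i : Fin 9, (r.CQ i).length ≤ r.DEG + 1) ∧
      r.msub ≤ r.S := by
  simp [encOK, Bool.and_eq_true, decide_eq_true_eq, and_assoc]

variable {r} (Fr : r.Frames) {g : GateData} {Λ : ℝ}

/-- Cover: `u ∈ [0,H]` lies in some sub-interval `a < KSUB`, with `a/KSUB ≤ u/H ≤ (a+1)/KSUB`.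
[folklore] -/
theorem exists_sub (hK : 0 < r.KSUB) (hH : (0 : ℝ) < r.Hq) {u : ℝ} (hu : u ∈ Icc 0 (r.Hq : ℝ)) :
    ∃ a < r.KSUB, (r.Ua a).mem r.P u ∧ (a : ℝ) / r.KSUB ≤ u / r.Hq ∧
      u / r.Hq ≤ ((a : ℝ) + 1) / r.KSUB := by
  obtain ⟨a, ha, h1, h2⟩ := exists_subinterval hK hH hu
  have hKr : (0 : ℝ) < r.KSUB := by exact_mod_cast hK
  refine ⟨a, ha, mem_subI r.P r.Hq r.KSUB a h1 h2, ?_, ?_⟩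
  · rw [le_div_iff₀ hH]
    calc (a : ℝ) / r.KSUB * r.Hq = (a : ℝ) * r.Hq / r.KSUB := by ring
      _ ≤ u := h1
  · rw [div_le_iff₀ hH]
    calc u ≤ ((a : ℝ) + 1) * r.Hq / r.KSUB := h2
      _ = ((a : ℝ) + 1) / r.KSUB * r.Hq := by ring

/-- A passing accumulation passes the sign test of every sub-interval. [folklore] -/
theorem signDef_sub (hsb : r.sb'.ok = true) {a : ℕ} (ha : a < r.KSUB) :
    signDef ((r.DXIon (r.Ua a)).get r.p) = true := by
  have h := (subsAcc_mono (r := r) r.pre r.ph'.rho r.KSUB a ha).2.2.2 (by rw [← sb'_eq]; exact hsb)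
  rw [sub_eq] at h
  exact h

section row

variable (hsb : r.sb'.ok = true) (henc : r.encOK = true) (hU : r.cU.Mem r.P g)
  (hD : r.cD.Mem r.P (scaled g Λ)) (hH : (0 : ℝ) < r.Hq) {u : ℝ} (hu : u ∈ Icc 0 (r.Hq : ℝ))
include hsb henc hU hD hH hu

/-- `Cert.hKB`: the coefficient hull over the row and over `ṡ ∈ [1−ρ, 1+ρ]`. [folklore] -/
theorem K_le {s : ℝ} (hs : |s - 1| ≤ r.rhoR) (i j : Fin 8) :
    |(Fr.ADm * Fr.Gv (u / r.Hq)) i.succ j +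
        s * (Fr.Av (u / r.Hq) * r.Ptm u * Jmat g Λ (xh r.CQ u) * Fr.Gv (u / r.Hq)) i.succ j +
          (if i = j then r.cR else 0)| ≤ r.BR i j := by
  obtain ⟨hK, hHlo, hlen, -⟩ := (encOK_iff r).mp henc
  obtain ⟨a, ha, hua, h0, h1⟩ := exists_sub hK hH hu
  have hs' : |s - 1| ≤ (r.ph'.rho : ℝ) / 2 ^ r.P := by simpa [rhoR, toR] using hs
  have hmK := (subsAcc_mono (r := r) r.pre r.ph'.rho r.KSUB a ha).1 _ _ _
    (mem_subK Fr hU hD hHlo hlen (signDef_sub hsb ha) hua h0 h1 hs' i j)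
  rw [← sb'_eq] at hmK
  have hdiag : (if i = j then (⟨r.c', r.c'⟩ : DI) else DI.pt 0).mem r.P
      (if i = j then r.cR else 0) := by
    split_ifs
    · simpa [DI.pt, cR, toR] using DI.mem_pt r.P r.c'
    · simpa using DI.mem_pt r.P 0
  have h := DI.abs_le_mag (DI.mem_add hmK hdiag)
  rw [BR, toR, B', Tab.at_mk']
  exact h

/-- `Cert.hCF`: the `e`-part forcing coefficients over the row. [folklore] -/
theorem CF_le (hρ : 0 ≤ r.ph'.rho) (i : Fin 8) (b : Fin 9) :
    |(Fr.ADm * Fr.Rv (u / r.Hq)) i.succ b| +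
        (1 + r.rhoR) *
          |(Fr.Av (u / r.Hq) * r.Ptm u * Jmat g Λ (xh r.CQ u) * Fr.Rv (u / r.Hq)) i.succ b| ≤
      r.CFR i b := by
  obtain ⟨hK, hHlo, hlen, -⟩ := (encOK_iff r).mp henc
  obtain ⟨a, ha, hua, h0, h1⟩ := exists_sub hK hH hu
  have h := CF_ge Fr hU hD hHlo hlen (signDef_sub hsb ha) hua h0 h1 hρ i.succ b
  have hm : (((r.sub r.pre r.ph'.rho a).CF.at i.succ b : ℤ) : ℝ) / 2 ^ r.P ≤ r.CFR i b := by
    rw [CFR, toR, sb'_eq]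
    exact div_le_div_of_nonneg_right
      (by exact_mod_cast (subsAcc_mono (r := r) r.pre r.ph'.rho r.KSUB a ha).2.1 i.succ b)
      (by positivity)
  have e : r.rhoR = (r.ph'.rho : ℝ) / 2 ^ r.P := rfl
  rw [e]
  exact h.trans hm

omit hU hD in
/-- `Cert.hAPm`: `|AP̃|` over the row. [folklore] -/
theorem APm_le (i : Fin 8) (b : Fin 9) :
    |(Fr.Av (u / r.Hq) * r.Ptm u) i.succ b| ≤ r.APmR i b := by
  obtain ⟨hK, hHlo, hlen, -⟩ := (encOK_iff r).mp henc
  obtain ⟨a, ha, hua, h0, h1⟩ := exists_sub hK hH hu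
  have h := APTM_ge Fr hlen (signDef_sub hsb ha) hua h0 h1 i.succ b
  have hm : (((r.sub r.pre r.ph'.rho a).APTM.at i.succ b : ℤ) : ℝ) / 2 ^ r.P ≤ r.APmR i b := by
    rw [APmR, toR, sb'_eq]
    exact div_le_div_of_nonneg_right
      (by exact_mod_cast (subsAcc_mono (r := r) r.pre r.ph'.rho r.KSUB a ha).2.2.1 i.succ b)
      (by positivity)
  exact h.trans hm

omit hsb henc hU hD in
/-- `Cert.hGm` in the real view `GmR`. [folklore] -/
theorem G_le (a : Fin 9) (i : Fin 8) : |Fr.Gv (u / r.Hq) a i| ≤ r.GmR a i := by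
  have hv : u / r.Hq ∈ Icc (0 : ℝ) 1 :=
    ⟨div_nonneg hu.1 hH.le, (div_le_one hH).mpr hu.2⟩
  exact Fr.Gm_le hv a i

omit hsb henc hU hD in
/-- `Cert.hRm` in the real view `RmR`. [folklore] -/
theorem R_le (a b : Fin 9) : |Fr.Rv (u / r.Hq) a b| ≤ r.RmR a b := by
  have hv : u / r.Hq ∈ Icc (0 : ℝ) 1 :=
    ⟨div_nonneg hu.1 hH.le, (div_le_one hH).mpr hu.2⟩
  exact Fr.Rm_le hv a b

omit hsb henc hH in
/-- `Cert.hJp` in the real view `JpmR`. [folklore] -/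
theorem Jp_le' (b : Fin 9) : |Jmat g Λ (xh r.CQ u) r.p b| ≤ r.JpmR b :=
  r.Jp_le hU hD hu b

omit hsb hU hD hH in
/-- `Cert.hΦ` in the real view `PhiloR`. [folklore] -/
theorem Philo_le' (hph : r.ph'.ok = true) : r.PhiloR ≤ |xhd r.CQ u r.p| := by
  obtain ⟨-, -, hlen, -⟩ := (encOK_iff r).mp henc
  have hs : signDef ((r.DXIon r.U).get r.p) = true := by
    rw [ph'_ok, Bool.and_eq_true] at hph; exact hph.1
  exact r.Philo_le hs (hlen r.p) hu

end row

end RowData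

end RowCheck

end Summit.NavierStokesRegularity.FluidComputer
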